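import Summits.AtomisticToContinuum.HydrodynamicLimit.Theorems.AntiMazurCoboundariesCorrectorPressureDecayKiferTangent
import Summits.AtomisticToContinuum.HydrodynamicLimit.Theorems.AntiMazurCoboundariesCorrectorPressureDecayTangentTightnessGeometry
import Literature.Analysis.FluidPDE.InfiniteHardSphereDynamics
import Mathlib.InformationTheory.KullbackLeibler.Basic

/-!
# Tangent tightness, II: the blown-up laws and their Laplace functionals (line `FirstLemma`, crux stmt-AtomisticToContinuum-14135)

Helper file of the registered stub `stub_tangentTightness : TangentTightness` (idea `kifer-compactification`,
`…KiferTangent.lean`), namespace `Summit.AtomisticToContinuum.HydrodynamicLimit.Theorems.KiferCompactification`.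
The finite-`N` side of the tightness of tangent families, as honest statements about LAWS ON CONFIGURATIONS:

* `weightLaw φ` — the base-point law `(φ/∫φ) dx` on `𝕋³` (a probability law, `isProbabilityMeasure_weightLaw`);
  `blowUpLaw σ φ N Q` — the BLOWN-UP LAW: the law on `PointConfig (ℝ³ × ℝ³)` of OVY's blow-up `blowUp ε_N x z`
  (`RegularStationaryState.lean` §OVY) under `(φ/∫φ) dx ⊗ Q` (the blow-up is jointly measurable: it is `localConfig` of
  the torus geometry, `measurable_blowUp`);
* `stub_laplaceFunctional_blowUpLaw` (REGISTERED stub): for `Q` carried by the hard-sphere domain,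
  `PointProcess.laplaceFunctional (blowUpLaw σ φ N Q) f = tangentLaplace σ φ N Q f` on `C_c⁺` — label sums are
  configuration sums (`injective_blowUpPoint`), Fubini, and the density `φ/∫φ`;
  `ae_mem_hardSphereDomain_of_klDiv_ne_top`: `KL(Q ‖ G_N) < ∞` puts `Q` on the hard-sphere domain;
* `laplaceFunctional_map_translate`: `L_{μ ∘ τ_u⁻¹}(f) = L_μ(f(· + u))`;
* `tendsto_tangentLaplace_translate_sub` — the SHIFT ESTIMATE: along any `N' → ∞`,
  `tangentLaplace(f(· + (a, 0))) - tangentLaplace(f) → 0` (seam lemma `blowUp_seam`, Haar invariance of `dx` on `𝕋³`,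
  uniform continuity of `φ`), the source of translation invariance of tangent states.

References: Olla–Varadhan–Yau 1993 §4 (4.1), Lemma 4.1; Kallenberg 2002 Ch. 16 (context).
-/

noncomputable section

open MeasureTheory ProbabilityTheory Set Filter Topology Function
open scoped ENNReal NNReal

namespace Summit.AtomisticToContinuum.HydrodynamicLimit.Theorems.KiferCompactification

open Literature.MathematicalPhysics.KineticTheory (T3 V3 hsDiameter hsDiameter_pos localGibbsLaw blowUpPoint
  blowUp)
open Literature.MathematicalPhysics.KineticTheory.PointProcess (laplaceFunctional measurable_exp_neg_finsum)
open Literature.Analysis.FluidPDE (HardSphereFlow Config IsHardCore hardSphereDomain)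
open Literature.Analysis.FunctionSpaces (PointConfig)
open Literature.Analysis.FluidPDE.Torus (reprSym)
open Literature.Analysis.FunctionSpaces.Torus (proj)

/-! ## The blown-up laws -/

/-- The `φ`-WEIGHTED BASE-POINT LAW on `𝕋³`: Haar measure with density `φ / ∫φ` (a probability law for continuous
`φ ≥ 0` with `∫φ > 0`). -/
def weightLaw (φ : T3 → ℝ) : Measure T3 :=
  volume.withDensity fun x => ((Real.toNNReal ((∫ y, φ y)⁻¹ * φ x) : ℝ≥0) : ℝ≥0∞)

/-- The weighted base-point law is a probability law. -/
theorem isProbabilityMeasure_weightLaw {φ : T3 → ℝ} (hφ : Continuous φ) (hφ0 : ∀ x, 0 ≤ φ x)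
    (hint : 0 < ∫ x, φ x) : IsProbabilityMeasure (weightLaw φ) := by
  constructor
  rw [weightLaw, withDensity_apply _ MeasurableSet.univ, Measure.restrict_univ]
  have hφi : Integrable φ volume := hφ.integrable_of_hasCompactSupport (HasCompactSupport.of_compactSpace φ)
  have h0 : ∀ x, 0 ≤ (∫ y, φ y)⁻¹ * φ x := fun x => mul_nonneg (inv_nonneg.2 hint.le) (hφ0 x)
  have h1 : (∫⁻ x, ((Real.toNNReal ((∫ y, φ y)⁻¹ * φ x) : ℝ≥0) : ℝ≥0∞)) =
      ENNReal.ofReal (∫ x, (∫ y, φ y)⁻¹ * φ x) := by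
    rw [ofReal_integral_eq_lintegral_ofReal (hφi.const_mul _) (ae_of_all _ h0)]
    rfl
  rw [h1, integral_const_mul, inv_mul_cancel₀ hint.ne', ENNReal.ofReal_one]

/-- The BLOWN-UP LAW of a law `Q` on `(N+1)`-particle torus phase space at reduced diameter `σ`, seen through the
weight `φ`: the law on configurations of `ℝ³ × ℝ³` of `blowUp ε_N x z` (`ε_N = hsDiameter σ N`) under
`(φ/∫φ) dx ⊗ Q` (a `φ`-weighted, single-time version of OVY's `Q^ε`, (4.1)). -/
def blowUpLaw (σ : ℝ) (φ : T3 → ℝ) (N : ℕ) (Q : Measure (Config (N + 1) (Fin 3) T3)) :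
    Measure (PointConfig (V3 × V3)) :=
  ((weightLaw φ).prod Q).map fun p => blowUp (hsDiameter σ N) p.1 p.2

/-- The blow-up map `(x, z) ↦ blowUp ε x z` is jointly measurable (it is `localConfig` of the torus geometry,
`measurable_localConfig`). -/
theorem measurable_blowUp (ε : ℝ) (N : ℕ) :
    Measurable fun p : T3 × Config N (Fin 3) T3 => blowUp ε p.1 p.2 :=
  Literature.Analysis.FluidPDE.measurable_localConfig (Literature.Analysis.FluidPDE.Torus.geometry (Fin 3))
    Literature.Analysis.FluidPDE.Torus.measurable_geometry_sepVec ε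

/-- Measurability of the label sums `∑ᵢ f(blowUpPoint ε x zᵢ)` in `(x, z)`. -/
theorem measurable_labelSum {ε : ℝ} {N : ℕ} {f : V3 × V3 → ℝ} (hf : Measurable f) :
    Measurable fun p : T3 × Config N (Fin 3) T3 => ∑ i, f (blowUpPoint ε p.1 (p.2 i)) := by
  refine Finset.measurable_sum _ fun i _ => hf.comp ?_
  have h1 : Measurable fun p : T3 × Config N (Fin 3) T3 => p.2 i := (measurable_pi_apply i).comp measurable_snd
  exact ((Literature.Analysis.FluidPDE.Torus.measurable_reprSym.comp (h1.fst.sub measurable_fst)).const_smul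
    ε⁻¹).prodMk h1.snd

/-- **The Laplace functional of the blown-up law is the tangent Laplace functional.** For `σ > 0`, continuous
`φ ≥ 0` with `∫φ > 0`, a probability law `Q` carried by the hard-sphere domain `D_{ε_N}` and `f ∈ C_c⁺(ℝ³ × ℝ³)`:
`L_{blowUpLaw σ φ N Q}(f) = tangentLaplace σ φ N Q f` — on `D_{ε_N}` the labelled blow-up is injective, so the
configuration sum `∑_{p ∈ blowUp} f p` is the label sum `∑ᵢ f (blowUpPoint ε_N x zᵢ)`; then Fubini and the density
`φ/∫φ`. Registered stub `stub_laplaceFunctional_blowUpLaw` of line `FirstLemma` (crux stmt-AtomisticToContinuum-14135),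
helper of `stub_tangentTightness`. -/
theorem stub_laplaceFunctional_blowUpLaw {σ : ℝ} (hσ : 0 < σ) {φ : T3 → ℝ} (hφ : Continuous φ)
    (hφ0 : ∀ x, 0 ≤ φ x) (hint : 0 < ∫ x, φ x) {N : ℕ} (Q : Measure (Config (N + 1) (Fin 3) T3))
    [IsProbabilityMeasure Q]
    (hQ : ∀ᵐ z ∂Q, z ∈ hardSphereDomain (Literature.Analysis.FluidPDE.Torus.geometry (Fin 3)) (N + 1)
      (hsDiameter σ N))
    {f : V3 × V3 → ℝ} (hf : Continuous f) (hfc : HasCompactSupport f) (hf0 : ∀ p, 0 ≤ f p) :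
    laplaceFunctional (blowUpLaw σ φ N Q) f = tangentLaplace σ φ N Q f := by
  have hε := hsDiameter_pos hσ N
  haveI := isProbabilityMeasure_weightLaw hφ hφ0 hint
  obtain ⟨F, hF⟩ : ∃ F : T3 × Config (N + 1) (Fin 3) T3 → ℝ,
      ∀ p, F p = Real.exp (-(∑ i, f (blowUpPoint (hsDiameter σ N) p.1 (p.2 i)))) := ⟨_, fun _ => rfl⟩
  have hFm : Measurable F := by
    rw [show F = fun p => Real.exp (-(∑ i, f (blowUpPoint (hsDiameter σ N) p.1 (p.2 i)))) from funext hF]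
    exact (measurable_labelSum hf.measurable).neg.exp
  have hF1 : ∀ p, ‖F p‖ ≤ 1 := fun p => by
    rw [hF, Real.norm_eq_abs, abs_of_nonneg (Real.exp_pos _).le, Real.exp_le_one_iff, neg_nonpos]
    exact Finset.sum_nonneg fun i _ => hf0 _
  -- (1) transport along the blow-up map: configuration sums are label sums on the hard-sphere domain
  have h1 : laplaceFunctional (blowUpLaw σ φ N Q) f = ∫ p, F p ∂((weightLaw φ).prod Q) := by
    rw [Literature.MathematicalPhysics.KineticTheory.PointProcess.laplaceFunctional, blowUpLaw,
      integral_map (measurable_blowUp _ _).aemeasurable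
        (measurable_exp_neg_finsum hf.measurable hfc hf0).aestronglyMeasurable]
    refine integral_congr_ae ?_
    have hae : ∀ᵐ p ∂((weightLaw φ).prod Q),
        p.2 ∈ hardSphereDomain (Literature.Analysis.FluidPDE.Torus.geometry (Fin 3)) (N + 1) (hsDiameter σ N) :=
      (Measure.quasiMeasurePreserving_snd).ae hQ
    filter_upwards [hae] with p hp
    rw [hF]
    congr 2
    have hinj := injective_blowUpPoint hε p.1 hp
    rw [show ((blowUp (hsDiameter σ N) p.1 p.2 : PointConfig (V3 × V3)) : Set (V3 × V3)) =
        Set.range (fun i => blowUpPoint (hsDiameter σ N) p.1 (p.2 i)) from rfl,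
      finsum_mem_range hinj, finsum_eq_sum_of_fintype]
  -- (2) Fubini and the density
  have hFi : Integrable F ((weightLaw φ).prod Q) :=
    Integrable.of_bound hFm.aestronglyMeasurable 1 (ae_of_all _ hF1)
  rw [h1, integral_prod _ hFi, weightLaw,
    integral_withDensity_eq_integral_smul (hφ.measurable.const_mul _).real_toNNReal]
  have hco : ∀ x, ((Real.toNNReal ((∫ y, φ y)⁻¹ * φ x) : ℝ≥0) : ℝ) = (∫ y, φ y)⁻¹ * φ x := fun x =>
    Real.coe_toNNReal _ (mul_nonneg (inv_nonneg.2 hint.le) (hφ0 x))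
  simp only [NNReal.smul_def, smul_eq_mul, hco, hF, mul_assoc]
  rw [integral_const_mul]
  rfl

/-- A law of finite relative entropy with respect to the local Gibbs law is carried by the hard-sphere domain
(`Q ≪ G_N = localGibbsMeasure ≪ liouville = dZ|_{D_ε}`). -/
theorem ae_mem_hardSphereDomain_of_klDiv_ne_top {σ : ℝ} {a₀ θ₀ : T3 → ℝ} {u₀ : T3 → V3} {N : ℕ}
    {Φ : HardSphereFlow (Literature.Analysis.FluidPDE.Torus.geometry (Fin 3)) (hsDiameter σ N) (N + 1)}
    {Q : Measure (Config (N + 1) (Fin 3) T3)}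
    (h : InformationTheory.klDiv Q (localGibbsLaw σ a₀ u₀ θ₀ N Φ) ≠ ⊤) :
    ∀ᵐ z ∂Q, z ∈ hardSphereDomain (Literature.Analysis.FluidPDE.Torus.geometry (Fin 3)) (N + 1)
      (hsDiameter σ N) := by
  have hac : Q ≪ localGibbsLaw σ a₀ u₀ θ₀ N Φ := (InformationTheory.klDiv_ne_top_iff.1 h).1
  have hac' : localGibbsLaw σ a₀ u₀ θ₀ N Φ ≪ Literature.Analysis.FluidPDE.liouville
      (Literature.Analysis.FluidPDE.Torus.geometry (Fin 3)) (N + 1) (hsDiameter σ N) := by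
    rw [Literature.MathematicalPhysics.KineticTheory.localGibbsLaw_eq]
    exact Literature.MathematicalPhysics.KineticTheory.localGibbsMeasure_absolutelyContinuous σ _ _ _ N Φ
  exact (hac.trans hac').ae_le (ae_restrict_mem (Literature.Analysis.FluidPDE.measurableSet_hardSphereDomain _
    Literature.Analysis.FluidPDE.Torus.measurable_geometry_sepVec _ _))

/-! ## Translates of the test function: the shift estimate -/

/-- Laplace functionals of translates: `L_{μ ∘ τ_u⁻¹}(f) = L_μ(f(· + u))` for measurable compactly supported
`f ≥ 0`. -/
theorem laplaceFunctional_map_translate (μ : Measure (PointConfig (V3 × V3))) {f : V3 × V3 → ℝ}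
    (hf : Measurable f) (hfc : HasCompactSupport f) (hf0 : ∀ p, 0 ≤ f p) (u : V3 × V3) :
    laplaceFunctional (μ.map (PointConfig.translate u)) f = laplaceFunctional μ (fun p => f (p + u)) := by
  rw [Literature.MathematicalPhysics.KineticTheory.PointProcess.laplaceFunctional,
    Literature.MathematicalPhysics.KineticTheory.PointProcess.laplaceFunctional,
    integral_map (PointConfig.measurable_translate u).aemeasurable
      (measurable_exp_neg_finsum hf hfc hf0).aestronglyMeasurable]
  refine integral_congr_ae (ae_of_all _ fun ω => ?_)
  simp only
  congr 2
  rw [PointConfig.coe_eq_carrier, PointConfig.carrier_translate, finsum_mem_image (add_left_injective u).injOn]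
  rfl

/-- **The shift estimate**: translating the test function by `(a, 0)` changes the tangent Laplace functional by
`o(1)` as `N → ∞`: along any `N' → ∞` and any probability laws `Q' n`,
`tangentLaplace (f(· + (a,0))) - tangentLaplace f → 0`. By the seam lemma the shifted label sum at base point `x`
is EXACTLY the unshifted one at `x - proj (ε a)` once `2ε(R + ‖a‖) < 1`; then Haar invariance of `dx` on `𝕋³`
and uniform continuity of `φ`. -/
theorem tendsto_tangentLaplace_translate_sub {σ : ℝ} (hσ : 0 < σ) {φ : T3 → ℝ} (hφ : Continuous φ)
    {N' : ℕ → ℕ} (hN' : Tendsto N' atTop atTop) (Q' : ∀ n, Measure (Config (N' n + 1) (Fin 3) T3))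
    (hQ' : ∀ n, IsProbabilityMeasure (Q' n)) {f : V3 × V3 → ℝ} (hf : Continuous f)
    (hfc : HasCompactSupport f) (hf0 : ∀ p, 0 ≤ f p) (a : V3) :
    Tendsto (fun n => tangentLaplace σ φ (N' n) (Q' n) (fun p => f (p + (a, 0))) -
      tangentLaplace σ φ (N' n) (Q' n) f) atTop (𝓝 0) := by
  -- support radius of `f` in the position variable
  obtain ⟨R, hR⟩ : ∃ R, ∀ p, f p ≠ 0 → ‖p.1‖ ≤ R := by
    obtain ⟨R, hR⟩ := hfc.isCompact.isBounded.subset_closedBall 0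
    refine ⟨R, fun p hp => (norm_fst_le p).trans ?_⟩
    have := hR (subset_tsupport f hp)
    rwa [Metric.mem_closedBall, dist_zero_right] at this
  have hε : ∀ n, 0 < hsDiameter σ (N' n) := fun n => hsDiameter_pos hσ _
  -- `ε_{N' n} → 0`
  have hε0 : Tendsto (fun n => hsDiameter σ (N' n)) atTop (𝓝 0) := by
    have h1 : Tendsto (fun N : ℕ => ((N + 1 : ℕ) : ℝ)) atTop atTop :=
      tendsto_natCast_atTop_atTop.comp (tendsto_add_atTop_nat 1)
    have h2 := (((tendsto_rpow_neg_atTop (by norm_num : (0 : ℝ) < 1 / 3)).comp h1).const_mul σ).comp hN'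
    rw [mul_zero] at h2
    exact h2
  -- `G n x = E_{Q' n}[exp(-∑ f(blown-up particles))]`
  obtain ⟨G, hG⟩ : ∃ G : ℕ → T3 → ℝ, ∀ n x,
      G n x = ∫ z, Real.exp (-(∑ i, f (blowUpPoint (hsDiameter σ (N' n)) x (z i)))) ∂(Q' n) :=
    ⟨_, fun _ _ => rfl⟩
  have hGm : ∀ n, StronglyMeasurable (G n) := fun n => by
    have h := ((measurable_labelSum (ε := hsDiameter σ (N' n)) (N := N' n + 1)
      hf.measurable).neg.exp.stronglyMeasurable).integral_prod_right' (ν := Q' n)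
    rw [show G n = fun x => ∫ z, Real.exp (-(∑ i, f (blowUpPoint (hsDiameter σ (N' n)) x (z i)))) ∂(Q' n)
      from funext (hG n)]
    exact h
  have hG1 : ∀ n x, ‖G n x‖ ≤ 1 := fun n x => by
    haveI := hQ' n
    rw [hG]
    have h := norm_integral_le_of_norm_le_const (μ := Q' n) (C := 1)
      (f := fun z : Config (N' n + 1) (Fin 3) T3 =>
        Real.exp (-(∑ i, f (blowUpPoint (hsDiameter σ (N' n)) x (z i)))))
      (Eventually.of_forall fun z => by
        rw [Real.norm_eq_abs, abs_of_nonneg (Real.exp_pos _).le, Real.exp_le_one_iff, neg_nonpos]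
        exact Finset.sum_nonneg fun i _ => hf0 _)
    rwa [probReal_univ, mul_one] at h
  -- eventually the seam lemma applies
  have hev : ∀ᶠ n in atTop, 2 * hsDiameter σ (N' n) * (R + ‖a‖) < 1 := by
    have h : Tendsto (fun n => 2 * hsDiameter σ (N' n) * (R + ‖a‖)) atTop (𝓝 (2 * 0 * (R + ‖a‖))) :=
      (hε0.const_mul 2).mul_const _
    rw [mul_zero, zero_mul] at h
    exact h.eventually (gt_mem_nhds one_pos)
  -- the exact identity for such `n`
  have hident : ∀ n, 2 * hsDiameter σ (N' n) * (R + ‖a‖) < 1 →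
      tangentLaplace σ φ (N' n) (Q' n) (fun p => f (p + (a, 0))) - tangentLaplace σ φ (N' n) (Q' n) f =
        (∫ x, φ x)⁻¹ * ∫ x, (φ (x + proj (hsDiameter σ (N' n) • a)) - φ x) * G n x := by
    intro n hn
    haveI := hQ' n
    set s : T3 := proj (hsDiameter σ (N' n) • a) with hs
    have hshift : ∀ (x : T3) (z : Config (N' n + 1) (Fin 3) T3),
        (∑ i, f (blowUpPoint (hsDiameter σ (N' n)) x (z i) + (a, 0))) =
          ∑ i, f (blowUpPoint (hsDiameter σ (N' n)) (x - s) (z i)) := by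
      intro x z
      refine Finset.sum_congr rfl fun i _ => ?_
      simp only [blowUpPoint, Prod.mk_add_mk, add_zero]
      rw [blowUp_seam (hε n) hn hR, hs]
      have e : (z i).1 - (x - proj (hsDiameter σ (N' n) • a)) = (z i).1 - x + proj (hsDiameter σ (N' n) • a) := by
        abel
      rw [e]
    have hL1 : tangentLaplace σ φ (N' n) (Q' n) (fun p => f (p + (a, 0))) =
        (∫ x, φ x)⁻¹ * ∫ x, φ (x + s) * G n x := by
      rw [tangentLaplace]
      congr 1
      simp only [hshift, ← hG]
      have h := integral_add_right_eq_self (μ := (volume : Measure T3)) (fun x => φ x * G n (x - s)) s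
      simp only [add_sub_cancel_right] at h
      exact h.symm
    have hL0 : tangentLaplace σ φ (N' n) (Q' n) f = (∫ x, φ x)⁻¹ * ∫ x, φ x * G n x := by
      rw [tangentLaplace]
      simp only [← hG]
    have hφs : Integrable (fun x => φ (x + s)) (volume : Measure T3) :=
      (hφ.comp (continuous_add_const s)).integrable_of_hasCompactSupport (HasCompactSupport.of_compactSpace _)
    have hi1 : Integrable (fun x => φ (x + s) * G n x) volume :=
      hφs.mul_bdd (hGm n).aestronglyMeasurable (ae_of_all _ (hG1 n))
    have hi0 : Integrable (fun x => φ x * G n x) volume :=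
      (hφ.integrable_of_hasCompactSupport (HasCompactSupport.of_compactSpace _)).mul_bdd
        (hGm n).aestronglyMeasurable (ae_of_all _ (hG1 n))
    rw [hL1, hL0, ← mul_sub, ← integral_sub hi1 hi0]
    congr 1
    refine integral_congr_ae (ae_of_all _ fun x => ?_)
    simp only
    ring
  -- uniform continuity of `φ` and `proj (ε_n a) → 0`
  set c : ℝ := (∫ x, φ x)⁻¹ with hc
  rw [Metric.tendsto_nhds]
  intro e he
  have hec : 0 < e / (|c| + 1) := by positivity
  obtain ⟨δ', hδ', hUC⟩ := Metric.uniformContinuous_iff.1 (CompactSpace.uniformContinuous_of_continuous hφ)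
    (e / (|c| + 1)) hec
  have hs0 : Tendsto (fun n => proj (hsDiameter σ (N' n) • a)) atTop (𝓝 0) := by
    have h1 : Tendsto (fun n => hsDiameter σ (N' n) • a) atTop (𝓝 ((0 : ℝ) • a)) := hε0.smul_const a
    rw [zero_smul] at h1
    have h2 := (Literature.Analysis.FunctionSpaces.Torus.continuous_proj.tendsto (0 : V3)).comp h1
    rwa [Literature.Analysis.FunctionSpaces.Torus.proj_zero] at h2
  have hev2 : ∀ᶠ n in atTop, dist (proj (hsDiameter σ (N' n) • a)) 0 < δ' := Metric.tendsto_nhds.1 hs0 δ' hδ'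
  filter_upwards [hev, hev2] with n hn hn2
  rw [Real.dist_eq, sub_zero, hident n hn]
  have hbound : ‖∫ x, (φ (x + proj (hsDiameter σ (N' n) • a)) - φ x) * G n x‖ ≤
      e / (|c| + 1) * (volume : Measure T3).real univ := by
    refine norm_integral_le_of_norm_le_const (Eventually.of_forall fun x => ?_)
    rw [norm_mul]
    have h1 : ‖φ (x + proj (hsDiameter σ (N' n) • a)) - φ x‖ ≤ e / (|c| + 1) := by
      have h := hUC (a := x + proj (hsDiameter σ (N' n) • a)) (b := x)
        (by rwa [dist_self_add_left, ← dist_zero_right])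
      rw [Real.dist_eq] at h
      exact h.le
    calc ‖φ (x + proj (hsDiameter σ (N' n) • a)) - φ x‖ * ‖G n x‖ ≤ e / (|c| + 1) * 1 :=
          mul_le_mul h1 (hG1 n x) (norm_nonneg _) hec.le
      _ = e / (|c| + 1) := mul_one _
  rw [probReal_univ, mul_one, Real.norm_eq_abs] at hbound
  calc |c * ∫ x, (φ (x + proj (hsDiameter σ (N' n) • a)) - φ x) * G n x|
      = |c| * |∫ x, (φ (x + proj (hsDiameter σ (N' n) • a)) - φ x) * G n x| := abs_mul _ _
    _ ≤ |c| * (e / (|c| + 1)) := by gcongr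
    _ = e * (|c| / (|c| + 1)) := by ring
    _ < e := mul_lt_of_lt_one_right he ((div_lt_one (by positivity)).2 (by linarith))

end Summit.AtomisticToContinuum.HydrodynamicLimit.Theorems.KiferCompactification
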